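import Summits.Ventures.HodgeRepro.FaceCensusRows12
import Summits.Ventures.HodgeRepro.FaceCensusStructural

/-!
# Proof of the order-12 census row `Duodecic.Dicyclic` (Dic₃) of `RankFourFaceCensus` (seat p4)

The structural clauses (counts of CM types / places / faces / type squares and the per-face properties `sumTwo`,
`cornersWF`, `noConjugateCorners`) come from `CMGaloisType.structural_rows` — generic theorems from the group axioms
alone, no enumeration; the group axioms `isCMGaloisType`, the dictionary with the Mathlib group `DicyclicGroup 3` (`conj ↦ a 3`), the orbit
representatives (`squareOrbitRepsFast reps`) and the orbit sizes (20 orbits, all of size 12) are kernel computations (`decide +kernel`).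
-/

namespace Summit.Ventures.HodgeRepro.FaceCensus.Duodecic.Dicyclic

/-- **Census row `Duodecic.Dicyclic`** (type Dic₃ of order `12`, as printed in `FaceCensusRows12.lean`): the Cayley
table is a group with `conj` a central involution `≠ 1`, identified with `DicyclicGroup 3` (`conj ↦ a 3`); `64` CM types, `6` places,
`1920` faces, `240` type squares; every face satisfies `SumTwo`, has four pairwise distinct CM-type corners and no two
complex-conjugate corners; the type squares form exactly the displayed orbits under the Galois twists (20 orbits, all of size 12). -/
theorem census : Census := by
  have h1 : Γ.isCMGaloisType = true := by decide +kernel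
  have hs := Γ.structural_rows h1 (by norm_num)
  exact ⟨h1, ⟨by decide +kernel, by decide +kernel, by decide +kernel⟩,
    ⟨hs.1.1.trans (by norm_num), hs.1.2.1.trans (by norm_num), hs.1.2.2.1.trans (by norm_num),
      hs.1.2.2.2.trans (by norm_num)⟩,
    hs.2.1, hs.2.2.1, hs.2.2.2, by decide +kernel, by decide +kernel⟩

end Summit.Ventures.HodgeRepro.FaceCensus.Duodecic.Dicyclic
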